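import Mathlib.NumberTheory.LSeries.HurwitzZetaEven
import Literature.NumberTheory.LFunctions.LagariasRains2003.Question
import HarnessLib

/-!
# Lagarias–Rains (2003) — the theta function `θ(t) = Σ_{n∈ℤ} e^{−π n² t}`

Elementary facts about `LagariasRains2003.theta` used by the representation (Theorem 2.1) and the
refutation of Question 1: `θ` is Mathlib's even Hurwitz kernel at `a = 0`, it satisfies the
transformation law `θ(1/t) = √t θ(t)`, `θ(t) − 1 = 2 Σ_{n≥1} e^{−π n² t}`, hence
`1 + 2e^{−πt} ≤ θ(t) ≤ 1 + 2e^{−πt}/(1 − e^{−πt})`, `θ` is antitone and continuous on `(0, ∞)`.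
-/

open Set Filter Topology HurwitzZeta

namespace Literature.NumberTheory.LFunctions.LagariasRains2003

/-- `θ` of (1.4) is the even Hurwitz zeta kernel with `a = 0`. [cite: LagariasRains2003, (1.4)] -/
theorem theta_eq_evenKernel {t : ℝ} (ht : 0 < t) : theta t = evenKernel 0 t := by
  have h := hasSum_int_evenKernel 0 ht
  simp only [add_zero, QuotientAddGroup.mk_zero] at h
  exact h.tsum_eq

/-- `Σ_{n∈ℤ} e^{−π n² t}` converges to `θ(t)` (`t > 0`). [cite: LagariasRains2003, (1.4)] -/
theorem hasSum_theta {t : ℝ} (ht : 0 < t) :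
    HasSum (fun n : ℤ => Real.exp (-Real.pi * (n : ℝ) ^ 2 * t)) (theta t) := by
  have h := hasSum_int_evenKernel 0 ht
  simp only [add_zero, QuotientAddGroup.mk_zero] at h
  rwa [theta_eq_evenKernel ht]

/-- `θ(t) − 1 = Σ_{n ≥ 0} 2 e^{−π (n+1)² t}` (`t > 0`). [cite: LagariasRains2003, (1.4)] -/
theorem hasSum_theta_sub_one {t : ℝ} (ht : 0 < t) :
    HasSum (fun n : ℕ => 2 * Real.exp (-Real.pi * ((n : ℝ) + 1) ^ 2 * t)) (theta t - 1) := by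
  have h := hasSum_nat_cosKernel₀ 0 ht
  simp only [mul_zero, zero_mul, Real.cos_zero, mul_one, QuotientAddGroup.mk_zero] at h
  rwa [theta_eq_evenKernel ht, evenKernel_eq_cosKernel_of_zero]

/-- The transformation law `θ(1/t) = t^{1/2} θ(t)` (`t > 0`; Poisson summation).
[cite: LagariasRains2003, (2.2)] -/
theorem theta_one_div {t : ℝ} (ht : 0 < t) : theta (1 / t) = t ^ (1 / 2 : ℝ) * theta t := by
  have h1 : 0 < 1 / t := by positivity
  rw [theta_eq_evenKernel ht, theta_eq_evenKernel h1, evenKernel_functional_equation 0 t,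
    evenKernel_eq_cosKernel_of_zero]
  have : t ^ (1 / 2 : ℝ) ≠ 0 := (Real.rpow_pos_of_pos ht _).ne'
  field_simp

/-- `θ(1/t²) = t θ(t²)` for `t > 0`. [cite: LagariasRains2003, (2.2)] -/
theorem theta_one_div_sq {t : ℝ} (ht : 0 < t) : theta (1 / t ^ 2) = t * theta (t ^ 2) := by
  rw [theta_one_div (by positivity)]
  congr 1
  rw [show (t ^ 2 : ℝ) = t ^ (2 : ℝ) by norm_cast, ← Real.rpow_mul ht.le]
  norm_num

/-- `1 + 2e^{−πt} ≤ θ(t)` (first term of the series). [cite: LagariasRains2003, (1.4)] -/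
theorem one_add_le_theta {t : ℝ} (ht : 0 < t) : 1 + 2 * Real.exp (-Real.pi * t) ≤ theta t := by
  have h := hasSum_theta_sub_one ht
  have := sum_le_hasSum (Finset.range 1) (fun n _ => by positivity) h
  simp only [Finset.sum_range_one, Nat.cast_zero, zero_add, one_pow, mul_one] at this
  linarith

/-- `1 ≤ θ(t)`. [cite: LagariasRains2003, (1.4)] -/
theorem one_le_theta {t : ℝ} (ht : 0 < t) : 1 ≤ theta t := by
  have := one_add_le_theta ht
  have := Real.exp_pos (-Real.pi * t)
  linarith

/-- `0 < θ(t)`. [cite: LagariasRains2003, (1.4)] -/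
theorem theta_pos {t : ℝ} (ht : 0 < t) : 0 < theta t := by linarith [one_le_theta ht]

/-- `θ(t) − 1 ≤ 2e^{−πt}/(1 − e^{−πt})` (compare with the geometric series, `n² ≥ n`).
[cite: LagariasRains2003, (1.4)] -/
theorem theta_sub_one_le {t : ℝ} (ht : 0 < t) :
    theta t - 1 ≤ 2 * Real.exp (-Real.pi * t) / (1 - Real.exp (-Real.pi * t)) := by
  set r := Real.exp (-Real.pi * t) with hr
  have hr0 : 0 ≤ r := (Real.exp_pos _).le
  have hr1 : r < 1 := by
    rw [hr]; apply Real.exp_lt_one_iff.mpr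
    have := Real.pi_pos; nlinarith
  have hg : HasSum (fun n : ℕ => 2 * r * r ^ n) (2 * r * (1 - r)⁻¹) :=
    (hasSum_geometric_of_lt_one hr0 hr1).mul_left (2 * r)
  have hle := hasSum_le (f := fun n : ℕ => 2 * Real.exp (-Real.pi * ((n : ℝ) + 1) ^ 2 * t))
    (g := fun n : ℕ => 2 * r * r ^ n) ?_ (hasSum_theta_sub_one ht) hg
  · simpa [div_eq_mul_inv] using hle
  intro n
  have : Real.exp (-Real.pi * ((n : ℝ) + 1) ^ 2 * t) ≤ r * r ^ n := by
    rw [hr, ← Real.exp_nat_mul, ← Real.exp_add]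
    apply Real.exp_le_exp.mpr
    have hn : (0 : ℝ) ≤ n := Nat.cast_nonneg n
    have hpt : 0 < Real.pi * t := by positivity
    nlinarith [mul_nonneg (mul_nonneg hn (by linarith : (0:ℝ) ≤ n + 1)) hpt.le]
  linarith

/-- `θ` is antitone on `(0, ∞)`. [cite: LagariasRains2003, (1.4)] -/
theorem theta_antitoneOn : AntitoneOn theta (Ioi 0) := by
  intro a ha b hb hab
  have h := hasSum_le (f := fun n : ℕ => 2 * Real.exp (-Real.pi * ((n : ℝ) + 1) ^ 2 * b))
    (g := fun n : ℕ => 2 * Real.exp (-Real.pi * ((n : ℝ) + 1) ^ 2 * a)) ?_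
    (hasSum_theta_sub_one hb) (hasSum_theta_sub_one ha)
  · linarith
  intro n
  have : Real.exp (-Real.pi * ((n : ℝ) + 1) ^ 2 * b) ≤ Real.exp (-Real.pi * ((n : ℝ) + 1) ^ 2 * a) := by
    apply Real.exp_le_exp.mpr
    have : 0 ≤ Real.pi * ((n : ℝ) + 1) ^ 2 := by positivity
    nlinarith [mem_Ioi.mp ha]
  linarith

/-- `θ` is continuous on `(0, ∞)`. [cite: LagariasRains2003, (1.4)] -/
theorem continuousOn_theta : ContinuousOn theta (Ioi 0) :=
  (continuousOn_evenKernel 0).congr fun _ ht => theta_eq_evenKernel ht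

end Literature.NumberTheory.LFunctions.LagariasRains2003
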